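import Summits.AnomalousDissipation.AnomalousDissipation.Theorems.TaylorGreenLoudGalerkinStates.Negative.Anatomy
import Summits.AnomalousDissipation.AnomalousDissipation.Theorems.TaylorCertificatesSmoothEulerCoerciveForceStubStrongForm
import Literature.Analysis.FunctionSpaces.TorusFluidGlueProofs
import Literature.Analysis.FunctionSpaces.TorusLerayHelmholtzProofs
import Literature.Analysis.FunctionSpaces.TorusCalculusProofs
import Literature.Analysis.FunctionSpaces.TorusTestFunction
import Literature.Analysis.FunctionSpaces.TorusSobolevSpaceProofs

/-!
# Kelvin pump on the Taylor–Green skeleton, part 1/2: line calculus, the edge lemma, the mirror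
# bookkeeping on `C = ∂([0,½]² × {x₂ = 0})`, the Kelvin datum `∮_C f_TG · dl = 4/π`, and the contradiction

Tools for `PumpedMirror.NoSmoothMirrorDodgerTG` (stmt-AnomalousDissipation-15374) and
`PumpedMirror.KelvinPumpSteadyTG` (stmt-AnomalousDissipation-15375).
§1 one-variable calculus along coordinate lines of `T³`; §2 weak ⇒ strong form `(v·∇)v + ∇p = f` with a smooth
pressure — IMPORTED from the landed `SmoothEulerCoerciveForce.Helical.stub_strongForm`
(`Theorems/TaylorCertificatesSmoothEulerCoerciveForceStubStrongForm.lean`; de Rham on `T³` via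
`Torus.smooth_helmholtz_holds`, Robinson–Rodrigo–Sadowski 2016 Thm. 2.6);
§3 on a coordinate segment `γ(s) = a + s eτ` lying in two mirror planes the normal components of a `K`-odd `v`
vanish, so `((v·∇)v)τ ∘ γ = ∂ₛ (vτ∘γ)²/2` and `(∇p)τ ∘ γ = ∂ₛ (p ∘ γ)`; with `vτ = 0` at the vertices the
fundamental theorem of calculus gives `∫₀^{1/2} fτ(γ(s)) ds = p(γ(½)) − p(γ(0))` (`edge_integral`);
§4 the four edges of the skeleton loop and the mirror conditions on them; §5 the Kelvin datum
(`tg_loop_circulation`, each edge contributes `∫₀^{1/2} sin 2πs ds = 1/π`; Brachet et al. 1983, §2);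
§6 summing the edge lemma around `C` the pressure telescopes to `0` against `4/π`: no smooth divergence-free
`K`-odd quiet Euler point of `f_TG` (`no_smooth_mirror_euler_state`).

References: M. E. Brachet, D. I. Meiron, S. A. Orszag, B. G. Nickel, R. H. Morf, U. Frisch, *Small-scale
structure of the Taylor–Green vortex*, J. Fluid Mech. 130 (1983) 411–452, §2 [doi:10.1017/s0022112083001159];
J. C. Robinson, J. L. Rodrigo, W. Sadowski, *The three-dimensional Navier–Stokes equations* (CUP 2016), Thm. 2.6
[RobinsonRodrigoSadowski2016].

TREE LANDING NOTE (decomp-ad census-1 g20, landing lane): the certified landable of decomp-ad lens-6 g61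
(`PumpedMirrorNoSmoothMirrorDodgerTG.lean`, sha256 6e267eb7354f0641…, 746 lines, farm rc 0 / 0 sorry / axioms
standard) exceeds the gate's 400-line limit for Theorems files with proofs (`lint.statement-form`), so it is
landed as TWO modules in the original order: this one (§1, §3–§6) → `PumpedMirrorNoSmoothMirrorDodgerTG`
(§7–§8: the rung and the two items); and the gate's `dedup.landed` identified the inlined §2
(`strongForm`, `strongForm_divergence_const`, `strongForm_isDivFree_sub_const`, `strongForm_hasZeroMean_sub_integral`,
`strongForm_eq_zero_of_integral_norm_sq_eq_zero`) with the landed `SmoothEulerCoerciveForce.Helical.stub_strongForm`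
and its helpers, so §2 is deleted here and the one use site in `no_smooth_mirror_euler_state` cites
`SmoothEulerCoerciveForce.Helical.stub_strongForm` (identical statement); likewise §5's `integral_sin_two_pi_mul`
(≡ `MirrorEnsembleMirrorStatisticsLoudTG.integral_sin_two_pi_mul`, whose module is not importable on the checking
farm) became a local `have` inside `tg_loop_circulation`. All other declarations byte-identical.
-/

-- every `Summit.AnomalousDissipation.AnomalousDissipation.…` name repeats the summit = problem segment (tree layout)
set_option linter.dupNamespace false

noncomputable section

open MeasureTheory
open scoped InnerProductSpace
open Literature.Analysis.FunctionSpaces Literature.Analysis.FunctionSpaces.Torus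
open Summit.AnomalousDissipation.AnomalousDissipation.Theorems.TaylorGreenLoudGalerkinStates.Negative
  (tgForce isSmooth_tgForce isDivFree_tgForce hasZeroMean_tgForce)

namespace Summit.AnomalousDissipation.AnomalousDissipation.Theorems.PumpedMirrorNoSmoothMirrorDodgerTG

/-! ## §1 One-variable calculus along coordinate lines of `T³` -/

/-- Chain rule along an affine line through the periodic lift: for smooth `g : T³ → F`,
`t ↦ g(proj(a + t e))` has derivative `Dg(proj(a + s e))[e]` at `s` (`Torus.fderiv_lift`). [folklore] -/
theorem hasDerivAt_line {F : Type*} [NormedAddCommGroup F] [NormedSpace ℝ F]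
    {g : UnitAddTorus (Fin 3) → F} (hg : IsSmooth g)
    (a e : EuclideanSpace ℝ (Fin 3)) (s : ℝ) :
    HasDerivAt (fun t : ℝ => g (proj (a + t • e))) (Torus.fderiv g (proj (a + s • e)) e) s := by
  have hd : DifferentiableAt ℝ (lift g) (a + s • e) :=
    (hg.differentiable (by simp)).differentiableAt
  have hγ : HasDerivAt (fun t : ℝ => a + t • e) e s := by
    simpa using ((hasDerivAt_id s).smul_const e).const_add a
  have h := hd.hasFDerivAt.comp_hasDerivAt s hγ
  rw [fderiv_lift] at h
  exact h

/-- Componentwise chain rule along an affine line for a smooth vector field `v : T³ → ℝ³`: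
`t ↦ vⱼ(proj(a + t e))` has derivative `(Dv(proj(a + s e))[e])ⱼ` at `s`. [folklore] -/
theorem hasDerivAt_line_apply {v : UnitAddTorus (Fin 3) → EuclideanSpace ℝ (Fin 3)} (hv : IsSmooth v)
    (a e : EuclideanSpace ℝ (Fin 3)) (j : Fin 3) (s : ℝ) :
    HasDerivAt (fun t : ℝ => v (proj (a + t • e)) j) ((Torus.fderiv v (proj (a + s • e)) e) j) s :=
  ((EuclideanSpace.proj j : EuclideanSpace ℝ (Fin 3) →L[ℝ] ℝ).hasFDerivAt.comp_hasDerivAt s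
    (hasDerivAt_line hv a e s))

/-- Components of the torus gradient: `(∇p(x))ᵢ = Dp(x)[eᵢ]` (`Torus.inner_gradient_left`). [folklore] -/
theorem gradient_apply_eq (p : UnitAddTorus (Fin 3) → ℝ) (x : UnitAddTorus (Fin 3)) (i : Fin 3) :
    Torus.gradient p x i = Torus.fderiv p x (EuclideanSpace.single i 1) := by
  have h : Torus.gradient p x i = ⟪Torus.gradient p x, EuclideanSpace.single i (1 : ℝ)⟫_ℝ := by
    rw [EuclideanSpace.inner_single_right]; simp
  rw [h, Torus.inner_gradient_left]

/-- The convective derivative of a field supported, at the point `x`, on the single axis `τ`: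
if `vᵢ(x) = 0` for `i ≠ τ` then `((v·∇)v)τ(x) = vτ(x) · (Dv(x)[eτ])τ`. [folklore] -/
theorem convect_apply_of_axis {v : UnitAddTorus (Fin 3) → EuclideanSpace ℝ (Fin 3)}
    (x : UnitAddTorus (Fin 3)) (τ : Fin 3) (hn : ∀ i, i ≠ τ → v x i = 0) :
    Torus.convect v v x τ = v x τ * (Torus.fderiv v x (EuclideanSpace.single τ 1)) τ := by
  have hvx : v x = (v x τ) • EuclideanSpace.single τ (1 : ℝ) := by
    ext i
    by_cases hi : i = τ
    · subst hi; simp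
    · simp [hi, hn i hi]
  rw [Torus.convect]
  conv_lhs => rw [hvx]
  rw [map_smul, PiLp.smul_apply, smul_eq_mul]

/-- Continuity of a component of a continuous field along an affine line of `T³`. [folklore] -/
theorem continuous_line_apply {f : UnitAddTorus (Fin 3) → EuclideanSpace ℝ (Fin 3)} (hf : Continuous f)
    (a e : EuclideanSpace ℝ (Fin 3)) (τ : Fin 3) :
    Continuous (fun s : ℝ => f (proj (a + s • e)) τ) := by
  have h1 : Continuous (fun s : ℝ => a + s • e) := by fun_prop
  exact ((EuclideanSpace.proj τ : EuclideanSpace ℝ (Fin 3) →L[ℝ] ℝ).continuous).comp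
    (hf.comp (continuous_proj.comp h1))

/-! ## §3 The edge lemma: forced Euler along a mirror edge -/

/-- **Edge lemma (Kelvin pump on one edge).** Let `(v·∇)v + ∇p = f` pointwise with `v`, `p` smooth and
`f` continuous, and let `γ(s) = proj(a + s eτ)` be a coordinate segment on which the components of `v`
normal to `eτ` vanish and whose end-values `vτ(γ 0) = vτ(γ ½) = 0`. Then
`∫₀^{1/2} fτ(γ s) ds = p(γ ½) − p(γ 0)`: along `γ`, `fτ = ∂ₛ((vτ∘γ)²/2 + p∘γ)` and the kinetic term drops
at the ends (fundamental theorem of calculus, `intervalIntegral.integral_eq_sub_of_hasDerivAt`). [folklore] -/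
theorem edge_integral {f v : UnitAddTorus (Fin 3) → EuclideanSpace ℝ (Fin 3)}
    {p : UnitAddTorus (Fin 3) → ℝ} (hv : IsSmooth v) (hp : IsSmooth p) (hf : Continuous f)
    (hE : ∀ x, Torus.convect v v x + Torus.gradient p x = f x)
    (a : EuclideanSpace ℝ (Fin 3)) (τ : Fin 3) (γ : ℝ → UnitAddTorus (Fin 3))
    (hγ : ∀ s, γ s = proj (a + s • EuclideanSpace.single τ 1))
    (hn : ∀ (s : ℝ) (i : Fin 3), i ≠ τ → v (γ s) i = 0)
    (h0 : v (γ 0) τ = 0) (h1 : v (γ (1 / 2)) τ = 0) :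
    ∫ s in (0 : ℝ)..(1 / 2), f (γ s) τ = p (γ (1 / 2)) - p (γ 0) := by
  obtain rfl : γ = fun s => proj (a + s • EuclideanSpace.single τ 1) := funext hγ
  set e : EuclideanSpace ℝ (Fin 3) := EuclideanSpace.single τ 1 with he
  -- the primitive `F(s) = vτ(γ s)²/2 + p(γ s)` has derivative `fτ(γ s)`
  have hF : ∀ s : ℝ, HasDerivAt
      (fun t : ℝ => v (proj (a + t • e)) τ * v (proj (a + t • e)) τ / 2 + p (proj (a + t • e)))
      (f (proj (a + s • e)) τ) s := by
    intro s
    have hg := hasDerivAt_line_apply hv a e τ s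
    have hh := hasDerivAt_line hp a e s
    have hsum := ((hg.mul hg).div_const 2).add hh
    refine hsum.congr_deriv ?_
    rw [← hE (proj (a + s • e)), PiLp.add_apply, convect_apply_of_axis _ τ (hn s),
      gradient_apply_eq, ← he]
    ring
  have hint : IntervalIntegrable (fun s : ℝ => f (proj (a + s • e)) τ) volume 0 (1 / 2) :=
    (continuous_line_apply hf a e τ).intervalIntegrable _ _
  have hftc := intervalIntegral.integral_eq_sub_of_hasDerivAt (fun s _ => hF s) hint
  rw [hftc]
  have h0' : v (proj (a + (0 : ℝ) • e)) τ = 0 := h0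
  have h1' : v (proj (a + (1 / 2 : ℝ) • e)) τ = 0 := h1
  simp only [h0', h1', mul_zero, zero_div, zero_add]

/-! ## §4 Mirror bookkeeping on the skeleton loop `C = ∂([0,½]² × {x₂ = 0})` -/

/-- `K`-oddness kills a component on its own mirror: if `vⱼ(σᵢ x) = ∓vⱼ(x)` coordinatewise and the point
`x` is fixed by `σᵢ` (`−xᵢ = xᵢ`), then `vᵢ(x) = 0`. [folklore] -/
theorem apply_eq_zero_of_fix {v : UnitAddTorus (Fin 3) → EuclideanSpace ℝ (Fin 3)}
    (hK : ∀ (i j : Fin 3) (x : UnitAddTorus (Fin 3)),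
      v (Function.update x i (-x i)) j = if j = i then -(v x j) else v x j)
    (x : UnitAddTorus (Fin 3)) (i : Fin 3) (hx : -x i = x i) : v x i = 0 := by
  have h := hK i i x
  rw [hx, Function.update_eq_self, if_pos rfl] at h
  linarith

/-- `½` is a fixed point of `t ↦ −t` on the unit circle `ℝ/ℤ`. [folklore] -/
theorem neg_half_coe : -(((1 / 2 : ℝ)) : UnitAddCircle) = ((1 / 2 : ℝ) : UnitAddCircle) := by
  rw [eq_comm, ← sub_eq_zero, sub_neg_eq_add, ← AddCircle.coe_add,
    show (1 / 2 : ℝ) + 1 / 2 = 1 by norm_num, AddCircle.coe_period]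

/-- Edge 1 of the skeleton loop: `s ↦ (s, 0, 0)`, tangent `e₀`. -/
def edge₁ (s : ℝ) : UnitAddTorus (Fin 3) :=
  ![((s : ℝ) : UnitAddCircle), ((0 : ℝ) : UnitAddCircle), ((0 : ℝ) : UnitAddCircle)]

/-- Edge 2 of the skeleton loop: `s ↦ (½, s, 0)`, tangent `e₁`. -/
def edge₂ (s : ℝ) : UnitAddTorus (Fin 3) :=
  ![(((1 / 2 : ℝ)) : UnitAddCircle), ((s : ℝ) : UnitAddCircle), ((0 : ℝ) : UnitAddCircle)]

/-- Edge 3 of the skeleton loop (traversed backwards): `s ↦ (s, ½, 0)`, tangent `e₀`. -/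
def edge₃ (s : ℝ) : UnitAddTorus (Fin 3) :=
  ![((s : ℝ) : UnitAddCircle), (((1 / 2 : ℝ)) : UnitAddCircle), ((0 : ℝ) : UnitAddCircle)]

/-- Edge 4 of the skeleton loop (traversed backwards): `s ↦ (0, s, 0)`, tangent `e₁`. -/
def edge₄ (s : ℝ) : UnitAddTorus (Fin 3) :=
  ![((0 : ℝ) : UnitAddCircle), ((s : ℝ) : UnitAddCircle), ((0 : ℝ) : UnitAddCircle)]

/-- Edge 1 is the projected line `s ↦ proj(0 + s e₀)`. [folklore] -/
theorem edge₁_eq (s : ℝ) :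
    edge₁ s = proj ((0 : EuclideanSpace ℝ (Fin 3)) + s • EuclideanSpace.single 0 1) := by
  funext i
  fin_cases i <;> simp [edge₁, proj_apply]

/-- Edge 2 is the projected line `s ↦ proj(½e₀ + s e₁)`. [folklore] -/
theorem edge₂_eq (s : ℝ) :
    edge₂ s = proj (((1 / 2 : ℝ) • EuclideanSpace.single 0 1 : EuclideanSpace ℝ (Fin 3)) +
      s • EuclideanSpace.single 1 1) := by
  funext i
  fin_cases i <;> simp [edge₂, proj_apply]

/-- Edge 3 is the projected line `s ↦ proj(½e₁ + s e₀)`. [folklore] -/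
theorem edge₃_eq (s : ℝ) :
    edge₃ s = proj (((1 / 2 : ℝ) • EuclideanSpace.single 1 1 : EuclideanSpace ℝ (Fin 3)) +
      s • EuclideanSpace.single 0 1) := by
  funext i
  fin_cases i <;> simp [edge₃, proj_apply]

/-- Edge 4 is the projected line `s ↦ proj(0 + s e₁)`. [folklore] -/
theorem edge₄_eq (s : ℝ) :
    edge₄ s = proj ((0 : EuclideanSpace ℝ (Fin 3)) + s • EuclideanSpace.single 1 1) := by
  funext i
  fin_cases i <;> simp [edge₄, proj_apply]

/-- The four edges close up: consecutive end points coincide (definitionally). [folklore] -/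
theorem edges_close :
    edge₂ 0 = edge₁ (1 / 2) ∧ edge₂ (1 / 2) = edge₃ (1 / 2) ∧ edge₄ (1 / 2) = edge₃ 0 ∧
      edge₄ 0 = edge₁ 0 :=
  ⟨rfl, rfl, rfl, rfl⟩

/-- On the skeleton loop a `K`-odd field is tangent to the edges and vanishes at the vertices:
the normal components vanish along each edge and the tangential component vanishes at `s = 0, ½`. [folklore] -/
theorem mirror_edge_conditions {v : UnitAddTorus (Fin 3) → EuclideanSpace ℝ (Fin 3)}
    (hK : ∀ (i j : Fin 3) (x : UnitAddTorus (Fin 3)),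
      v (Function.update x i (-x i)) j = if j = i then -(v x j) else v x j) :
    ((∀ (s : ℝ) (i : Fin 3), i ≠ 0 → v (edge₁ s) i = 0) ∧ v (edge₁ 0) 0 = 0 ∧
        v (edge₁ (1 / 2)) 0 = 0) ∧
      ((∀ (s : ℝ) (i : Fin 3), i ≠ 1 → v (edge₂ s) i = 0) ∧ v (edge₂ 0) 1 = 0 ∧
        v (edge₂ (1 / 2)) 1 = 0) ∧
      ((∀ (s : ℝ) (i : Fin 3), i ≠ 0 → v (edge₃ s) i = 0) ∧ v (edge₃ 0) 0 = 0 ∧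
        v (edge₃ (1 / 2)) 0 = 0) ∧
      ((∀ (s : ℝ) (i : Fin 3), i ≠ 1 → v (edge₄ s) i = 0) ∧ v (edge₄ 0) 1 = 0 ∧
        v (edge₄ (1 / 2)) 1 = 0) := by
  have fix : ∀ (x : UnitAddTorus (Fin 3)) (i : Fin 3), -x i = x i → v x i = 0 :=
    fun x i hx => apply_eq_zero_of_fix hK x i hx
  refine ⟨⟨fun s i hi => ?_, fix _ 0 ?_, fix _ 0 ?_⟩, ⟨fun s i hi => ?_, fix _ 1 ?_, fix _ 1 ?_⟩,
    ⟨fun s i hi => ?_, fix _ 0 ?_, fix _ 0 ?_⟩, ⟨fun s i hi => ?_, fix _ 1 ?_, fix _ 1 ?_⟩⟩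
  · fin_cases i
    · exact absurd rfl hi
    · exact fix _ 1 (by simp [edge₁])
    · exact fix _ 2 (by simp [edge₁])
  · simp [edge₁]
  · simpa [edge₁] using neg_half_coe
  · fin_cases i
    · exact fix _ 0 (by simpa [edge₂] using neg_half_coe)
    · exact absurd rfl hi
    · exact fix _ 2 (by simp [edge₂])
  · simp [edge₂]
  · simpa [edge₂] using neg_half_coe
  · fin_cases i
    · exact absurd rfl hi
    · exact fix _ 1 (by simpa [edge₃] using neg_half_coe)
    · exact fix _ 2 (by simp [edge₃])
  · simp [edge₃]
  · simpa [edge₃] using neg_half_coe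
  · fin_cases i
    · exact fix _ 0 (by simp [edge₄])
    · exact absurd rfl hi
    · exact fix _ 2 (by simp [edge₄])
  · simp [edge₄]
  · simpa [edge₄] using neg_half_coe

/-! ## §5 The Kelvin datum: `∮_C f_TG · dl = 4/π`

Re-derived from `Theorems/MirrorEnsembleMirrorStatisticsLoudTGStubEulerCoerciveKTools.lean`
(`tgForce_edges`, `tg_loop_circulation`), whose module is not built on the checking farm. -/

-- adapted from Summits/AnomalousDissipation/AnomalousDissipation/Theorems/MirrorEnsembleMirrorStatisticsLoudTGStubEulerCoerciveKTools.lean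
/-- `e₁(x) = exp(2πix)` on the unit circle (Mathlib `fourier_coe_apply`). [folklore] -/
theorem fourier_one_coe (x : ℝ) :
    (fourier 1 ((x : ℝ) : UnitAddCircle) : ℂ) = Complex.exp ((2 * Real.pi * x : ℝ) * Complex.I) := by
  rw [fourier_coe_apply]
  congr 1
  push_cast
  ring

/-- The tangential component of `f_TG` along the four edges of the skeleton loop is `± sin 2πs`
(`f_TG = (sin2πx₀ cos2πx₁ cos2πx₂, −cos2πx₀ sin2πx₁ cos2πx₂, 0)`, `e₁(x) = exp(2πix)`). [folklore] -/
theorem tgForce_edges (s : ℝ) :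
    tgForce (edge₁ s) 0 = Real.sin (2 * Real.pi * s) ∧
      tgForce (edge₂ s) 1 = Real.sin (2 * Real.pi * s) ∧
      tgForce (edge₃ s) 0 = -Real.sin (2 * Real.pi * s) ∧
      tgForce (edge₄ s) 1 = -Real.sin (2 * Real.pi * s) := by
  have hπ : 2 * Real.pi * (1 / 2 : ℝ) = Real.pi := by ring
  simp only [tgForce, edge₁, edge₂, edge₃, edge₄, PiLp.toLp_apply, Matrix.cons_val_zero,
    Matrix.cons_val_one, Matrix.cons_val_two, Matrix.head_cons, Matrix.tail_cons, fourier_one_coe,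
    Complex.exp_ofReal_mul_I_re, Complex.exp_ofReal_mul_I_im, mul_zero, Real.cos_zero, hπ, Real.cos_pi]
  refine ⟨by ring, by ring, by ring, by ring⟩

/-- **The Kelvin datum.** The circulation of the Taylor–Green force around the skeleton loop
`C = ∂([0,½]² × {x₂ = 0})`, written as four edge integrals (edges 3 and 4 reversed), is `4/π`
(Brachet et al. 1983, §2). [folklore] -/
theorem tg_loop_circulation :
    (∫ s in (0 : ℝ)..(1 / 2), tgForce (edge₁ s) 0) + (∫ s in (0 : ℝ)..(1 / 2), tgForce (edge₂ s) 1) -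
      (∫ s in (0 : ℝ)..(1 / 2), tgForce (edge₃ s) 0) - (∫ s in (0 : ℝ)..(1 / 2), tgForce (edge₄ s) 1) =
      4 / Real.pi := by
  -- `∫₀^{1/2} sin 2πs ds = 1/π` (= the landed `MirrorEnsembleMirrorStatisticsLoudTG.integral_sin_two_pi_mul`, kept as a
  -- local `have`: that module is not importable on the checking farm)
  have integral_sin_two_pi_mul : ∫ s in (0 : ℝ)..(1 / 2), Real.sin (2 * Real.pi * s) = 1 / Real.pi := by
    rw [intervalIntegral.integral_comp_mul_left Real.sin (by positivity : (2 * Real.pi : ℝ) ≠ 0), integral_sin,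
      mul_zero, Real.cos_zero, show 2 * Real.pi * (1 / 2 : ℝ) = Real.pi by ring, Real.cos_pi, smul_eq_mul]
    field_simp
    norm_num
  simp_rw [fun s => (tgForce_edges s).1, fun s => (tgForce_edges s).2.1, fun s => (tgForce_edges s).2.2.1,
    fun s => (tgForce_edges s).2.2.2, intervalIntegral.integral_neg, integral_sin_two_pi_mul]
  ring

/-! ## §6 The item -/

/-- **No smooth mirror dodger for `f_TG` (Kelvin pump).** For every smooth divergence-free `K`-odd field
`v` on `T³` and every smooth `p` with `(v·∇)v + ∇p = f_TG`, summing the edge lemma around the skeleton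
loop gives `∮_C f_TG · dl = 0`, contradicting the Kelvin datum `4/π`. Hence no smooth divergence-free
`K`-odd `v` is a steady weak Euler state of `f_TG`. [folklore] -/
theorem no_smooth_mirror_euler_state (v : UnitAddTorus (Fin 3) → EuclideanSpace ℝ (Fin 3))
    (hvs : IsSmooth v) (hvd : IsDivFree v)
    (hK : ∀ (i j : Fin 3) (x : UnitAddTorus (Fin 3)),
      v (Function.update x i (-x i)) j = if j = i then -(v x j) else v x j)
    (hq : ∀ w : UnitAddTorus (Fin 3) → EuclideanSpace ℝ (Fin 3), IsSmooth w → IsDivFree w →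
      HasZeroMean w → ∫ x, inner ℝ (Torus.convect v v x - tgForce x) (w x) = 0) : False := by
  obtain ⟨p, hp, hE⟩ :=
    SmoothEulerCoerciveForce.Helical.stub_strongForm tgForce v isSmooth_tgForce hasZeroMean_tgForce hvs hvd hq
  obtain ⟨⟨n1, a1, b1⟩, ⟨n2, a2, b2⟩, ⟨n3, a3, b3⟩, ⟨n4, a4, b4⟩⟩ := mirror_edge_conditions hK
  have hfc : Continuous tgForce := isSmooth_tgForce.continuous
  have e1 := edge_integral hvs hp hfc hE 0 0 edge₁ edge₁_eq n1 a1 b1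
  have e2 := edge_integral hvs hp hfc hE _ 1 edge₂ edge₂_eq n2 a2 b2
  have e3 := edge_integral hvs hp hfc hE _ 0 edge₃ edge₃_eq n3 a3 b3
  have e4 := edge_integral hvs hp hfc hE 0 1 edge₄ edge₄_eq n4 a4 b4
  have hloop := tg_loop_circulation
  obtain ⟨c12, c23, c43, c41⟩ := edges_close
  rw [e1, e2, e3, e4, c12, c23, c43, c41] at hloop
  have hπ : 0 < 4 / Real.pi := by positivity
  linarith

end Summit.AnomalousDissipation.AnomalousDissipation.Theorems.PumpedMirrorNoSmoothMirrorDodgerTG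

end
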